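import Mathlib
import HarnessLib
import Summits.Ventures.LatticeQCDFlow.Exactness.SampleESS

/-!
# The Kish ESS composes HARMONICALLY in the squared populations: `1/ESS(pool) = Σ_k p_k²/ESS_k`

HONEST FRAMING: exact (Metropolis-corrected) sampling algorithms for lattice gauge theory;
figures of merit are autocorrelation/cost numbers at stated couplings and volumes; no
continuum-physics claim.

Venture `LatticeQCDFlow` (cell pub-lqcd), topic `Exactness`; FANOUT row 13 (`eng-snf`, GEN-25).
NEW WORK of the cell (elementary algebra) on the BUILT parent `Exactness/SampleESS` (`essHat`);
not a published result; no definition; nothing cited as a fact (Kish NAMED ONLY).  The master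
identity behind GEN-25's `NCMCGeneralSpaceKishPooling` (ceiling `ESS(pooled) ≤ Σ_k ESS_k`) and
`NCMCGeneralSpaceKishPoolingFloor` (floor `min_k ESS_k ≤ ESS(pooled)`).

WHY (row 13).  `estimators.sector_weights(Q, W)` boards THREE kinds of numbers from one weighted
sample partitioned into blocks (topological sectors `Q = k`; equally streams or contiguous
blocks): the reweighted populations `p_k = Σ_{Q=k} w / Σ w`, the block Kish fractions
`ess_k = essHat(w|_{Q=k})` with block sizes `n_k`, and `ess_pooled = essHat(w)` with `N = Σ n_k`.
They are tied by ONE exact identity — with block sums `a_k = Σ_{Q=k} w > 0`, `b_k = Σ_{Q=k} w²`,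
`A = Σ_k a_k`: `p_k²/ESS_k = (a_k/A)²·(b_k/a_k²) = b_k/A²`, hence

  **`1/ESS(pooled) = Σ_k p_k² / ESS(block k)`**, i.e.
  **`(N·ess_pooled)⁻¹ = Σ_k p_k²/(n_k·ess_k)`**  (`inv_card_mul_essHat_sigma_eq_sum`;
  raw form `inv_sq_sum_div_eq_sum`).

Both pooling bounds are one line from it (`Σ_k p_k = 1`: Cauchy–Schwarz gives the ceiling,
`Σ_k p_k² ≤ 1` the floor), and it says precisely how a sector that is rarely populated AFTER
reweighting (`p_k` small) can have a terrible `ess_k` without hurting `ess_pooled`, while the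
dominant sector's `ess_k` essentially IS the pooled one — the reading rule for F2's
`ess_per_sector_min` next to `ess_pooled`.

* `inv_sq_sum_div_eq_sum` — `(ΣΣw²)/(ΣΣw)² = Σ_k (a_k/A)²·(b_k/a_k²)`;
* **`inv_card_mul_essHat_sigma_eq_sum`** — the `essHat` form over the pooled index type `Σ k, J k`.

NOT CLAIMED: anything about the population ESS; anything numerical.
-/

namespace Summit.Ventures.LatticeQCDFlow.Exactness.GeneralNCMC

open Finset Summit.Ventures.LatticeQCDFlow.Exactness

section Harmonic

variable {ι : Type*} [Fintype ι] {J : ι → Type*} [∀ r, Fintype (J r)]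

/-- **Raw form**: `(Σ_k b_k)/(Σ_k a_k)² = Σ_k (a_k/A)²·(b_k/a_k²)` for block sums `a_k ≠ 0`
(`A = Σ_k a_k`; no sign or nondegeneracy needed beyond `a_k ≠ 0`). -/
theorem inv_sq_sum_div_eq_sum (a b : ι → ℝ) (ha : ∀ r, a r ≠ 0) :
    (∑ r, b r) / (∑ r, a r) ^ 2 = ∑ r, (a r / ∑ s, a s) ^ 2 * (b r / a r ^ 2) := by
  rw [sum_div]
  refine sum_congr rfl fun r _ => ?_
  have h := ha r
  rw [div_pow]
  field_simp

/-- `n · essHat v = (Σ v)²/Σ v²` (private restatement; the companion files' copies have no object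
file yet). -/
private theorem card_mul_essHat_eq_aux' {κ : Type*} [Fintype κ] (v : κ → ℝ)
    (hpos : 0 < ∑ j, v j ^ 2) (hcard : 0 < Fintype.card κ) :
    (Fintype.card κ : ℝ) * essHat v = (∑ j, v j) ^ 2 / ∑ j, v j ^ 2 := by
  unfold essHat
  have hc : (Fintype.card κ : ℝ) ≠ 0 := by positivity
  field_simp

/-- A block carrying weight (`Σ v > 0`) has a positive sum of squares. -/
theorem sum_sq_pos_of_sum_pos {κ : Type*} [Fintype κ] (v : κ → ℝ)
    (hpos : 0 < ∑ j, v j) : 0 < ∑ j, v j ^ 2 := by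
  obtain ⟨j, _, hj⟩ := exists_ne_zero_of_sum_ne_zero hpos.ne'
  exact sum_pos' (fun i _ => sq_nonneg (v i)) ⟨j, mem_univ _, by positivity⟩

/-- **`(N·ess_pooled)⁻¹ = Σ_k p_k²/(n_k·ess_k)`** — the Kish ESS COUNT composes harmonically in
the squared reweighted populations `p_k = (Σ_{block k} w)/(Σ w)` (every block nonempty with a
positive weight sum). -/
theorem inv_card_mul_essHat_sigma_eq_sum [Nonempty ι] (w : (r : ι) → J r → ℝ)
    (hpos : ∀ r, 0 < ∑ j, w r j) (hne : ∀ r, 0 < Fintype.card (J r)) :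
    ((Fintype.card (Σ r, J r) : ℝ) * essHat (fun p : (Σ r, J r) => w p.1 p.2))⁻¹
      = ∑ r, ((∑ j, w r j) / ∑ p : (Σ r, J r), w p.1 p.2) ^ 2
          / ((Fintype.card (J r) : ℝ) * essHat (w r)) := by
  have hsq : ∀ r, 0 < ∑ j, w r j ^ 2 := fun r => sum_sq_pos_of_sum_pos _ (hpos r)
  have h1 : (∑ p : (Σ r, J r), w p.1 p.2) = ∑ r, ∑ j, w r j := by
    rw [← Finset.univ_sigma_univ, Finset.sum_sigma]
  have h2 : (∑ p : (Σ r, J r), w p.1 p.2 ^ 2) = ∑ r, ∑ j, w r j ^ 2 := by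
    rw [← Finset.univ_sigma_univ, Finset.sum_sigma]
  have hposS : 0 < ∑ p : (Σ r, J r), w p.1 p.2 ^ 2 := by
    rw [h2]; exact sum_pos (fun r _ => hsq r) univ_nonempty
  have hcardS : 0 < Fintype.card (Σ r, J r) := by
    rw [Fintype.card_sigma]; exact sum_pos (fun r _ => hne r) univ_nonempty
  rw [card_mul_essHat_eq_aux' _ hposS hcardS, inv_div, h1, h2]
  have hblock : ∀ r,
      ((∑ j, w r j) / ∑ s, ∑ j, w s j) ^ 2 / ((Fintype.card (J r) : ℝ) * essHat (w r))
      = ((∑ j, w r j) / ∑ s, ∑ j, w s j) ^ 2 * ((∑ j, w r j ^ 2) / (∑ j, w r j) ^ 2) := fun r => by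
    rw [card_mul_essHat_eq_aux' _ (hsq r) (hne r), div_div_eq_mul_div, ← mul_div_assoc]
  simp_rw [hblock]
  exact inv_sq_sum_div_eq_sum (fun r => ∑ j, w r j) (fun r => ∑ j, w r j ^ 2) fun r => (hpos r).ne'

end Harmonic

end Summit.Ventures.LatticeQCDFlow.Exactness.GeneralNCMC
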